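import Mathlib
import HarnessLib
import Summits.NavierStokesRegularity.NavierStokesRegularity.Theorems.UnthreadedDoorCellFluxDefs
import Summits.NavierStokesRegularity.NavierStokesRegularity.Theorems.UnthreadedDoorCellFluxGlue
import Summits.NavierStokesRegularity.NavierStokesRegularity.Theorems.UnthreadedDoorNetFluxNearCentreFlux

/-!
# Route `UnthreadedDoor`, crux `PoloidalLiouville` (stmt-NavierStokesRegularity-1222), WALL W1 — crux idea «cell-flux», support toward
# Σ-0bR₂ `ClusterFluxNearCentreLipschitz`: the SHEET-FREE case (every admissible rule is the net flux there)

Σ-0bR₂ (`Theorems/UnthreadedDoorCellFluxWindowDecayDefs.lean`, p726325; custodian ns-idea-14, CellFluxSketch v1.2.16) asks, for EVERY admissible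
cluster rule `𝒞` of linked smooth window data `(v, x₀, T)`, the `r`- and `t`-Lipschitz control of the cluster flux
`a ↦ clusterFlux (T t) a (𝒞 t a)` near the centre with the NF-6 constants (`κ a₀` on `(0, a₀)`, `κ a² |t − t'|`).  This file isolates WHERE its
content lies: on every sphere `S_a(x₀)` that carries NO SHEET TRACE of `T t` (all sphere-critical points isolated — e.g. finitely many), a
cluster partition is necessarily the one-class family `{S_a(x₀)}` (`eq_singleton_of_isClusterPartition`), so the cluster flux of ANY rule IS the
net flux there (`clusterFlux_eq_netFlux_of_isClusterPartition`), and the landed NF-6 `NetFlux.nearCentreFlux` (p668552) delivers both Lipschitz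
conjuncts with the same `κ = π(2L + M)`:

* `nearCentreLipschitz_of_eq_netFlux` — transfer: a rule whose flux agrees with the net flux on `[t₁,t₂] × (0,1)` satisfies Σ-0bR₂'s conclusion;
* `clusterFluxNearCentreLipschitz_of_sheetFree` — Σ-0bR₂'s binder list VERBATIM with ONE extra hypothesis
  `∀ t ∈ Icc t₁ t₂, ∀ a ∈ Ioo 0 1, sheetTrace (T t) x₀ a = ∅` inserted before `∀ 𝒞`, conclusion VERBATIM;
* `clusterFluxNearCentreLipschitz_of_sphCritFinite` — the same with `(sphCrit (T t) x₀ a).Finite` (finite-critical small spheres, the K3ᶠ regime).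

So the open content of Σ-0bR₂ is confined to the window's spheres of radius `< 1` that DO carry sheet traces (re-grouping of several cells); the
companion file `UnthreadedDoorCellFluxLipschitzSelection.lean` lands the selection lemma that handles finitely many re-grouping events.

HONEST LABEL: support lemmas strictly below W1; Σ-0bR₂ itself, the cell-flux chain, `PoloidalLiouville` ⟨1222⟩, W1 and NS regularity are OPEN —
NOT proved.  `--supports stmt-NavierStokesRegularity-1222 --as helper`.  [folklore]
-/

noncomputable section

-- the summit and its single sub-problem share the name (CONVENTIONS §1)
set_option linter.dupNamespace false

open Set Function Filter Topology MeasureTheory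
open scoped RealInnerProductSpace

namespace Summit.NavierStokesRegularity.NavierStokesRegularity.Theorems.PoloidalLiouville.CellFlux

open Summit.NavierStokesRegularity.NavierStokesRegularity.Theorems.PoloidalLiouville.NetFlux
  (E3 sphSup sphInf sphOsc netFlux nearCentreFlux)
open Literature.Analysis Literature.Analysis.FluidPDE

/-! ### One cell ⇒ one class -/

/-- **On a sheet-free sphere every cluster partition is `{S_r(x₀)}`** (`r > 0`): the only cell is the sphere (`cellSet_eq_of_sheetTrace_empty`,
p693177), every class is a nonempty union of cells, hence the sphere, and the classes cover the nonempty sphere. [folklore] -/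
theorem eq_singleton_of_isClusterPartition {f : E3 → ℝ} {x₀ : E3} {r : ℝ} {𝒦 : Set (Set E3)} (hr : 0 < r)
    (h : sheetTrace f x₀ r = ∅) (h𝒦 : IsClusterPartition f x₀ r 𝒦) : 𝒦 = {Metric.sphere x₀ r} := by
  obtain ⟨_, hcls, hcov, _⟩ := h𝒦
  have hcell : cellSet f x₀ r = {Metric.sphere x₀ r} := cellSet_eq_of_sheetTrace_empty hr h
  -- every class is the sphere
  have hK : ∀ K ∈ 𝒦, K = Metric.sphere x₀ r := by
    intro K hK
    obtain ⟨hne, 𝒪, h𝒪, rfl⟩ := hcls K hK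
    rw [hcell] at h𝒪
    rcases Set.subset_singleton_iff_eq.1 h𝒪 with h0 | h1
    · subst h0
      simp at hne
    · subst h1
      exact Set.sUnion_singleton _
  -- and there is a class, since the classes cover the (nonempty) sphere
  have hne : 𝒦.Nonempty := by
    rw [h, Set.sdiff_empty] at hcov
    obtain ⟨x, hx⟩ : (Metric.sphere x₀ r).Nonempty := (NormedSpace.sphere_nonempty).2 hr.le
    rw [← hcov] at hx
    obtain ⟨K, hK, _⟩ := Set.mem_sUnion.1 hx
    exact ⟨K, hK⟩
  exact Set.eq_singleton_iff_nonempty_unique_mem.2 ⟨hne, hK⟩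

/-- **On a sheet-free sphere the cluster flux of every cluster partition is the net flux** (`r > 0`). [folklore] -/
theorem clusterFlux_eq_netFlux_of_isClusterPartition {f : E3 → ℝ} {x₀ : E3} {r : ℝ} {𝒦 : Set (Set E3)} (hr : 0 < r)
    (h : sheetTrace f x₀ r = ∅) (h𝒦 : IsClusterPartition f x₀ r 𝒦) : clusterFlux f r 𝒦 = netFlux f x₀ r := by
  rw [eq_singleton_of_isClusterPartition hr h h𝒦, clusterFlux_singleton]
  rfl

/-- Finite-critical version: on a sphere with finitely many sphere-critical points the cluster flux of every cluster partition is the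
net flux (`sheetTrace_eq_empty_of_finite`, p693177). [folklore] -/
theorem clusterFlux_eq_netFlux_of_sphCrit_finite {f : E3 → ℝ} {x₀ : E3} {r : ℝ} {𝒦 : Set (Set E3)} (hr : 0 < r)
    (h : (sphCrit f x₀ r).Finite) (h𝒦 : IsClusterPartition f x₀ r 𝒦) : clusterFlux f r 𝒦 = netFlux f x₀ r :=
  clusterFlux_eq_netFlux_of_isClusterPartition hr (sheetTrace_eq_empty_of_finite h) h𝒦

/-! ### Transfer of NF-6 to rules that coincide with the net flux near the centre -/

/-- **Transfer lemma.**  For linked smooth window data (NF-6's binder block) and ANY family `𝒞 t a` of classes whose cluster flux coincides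
with the net flux on `[t₁,t₂] × (0,1)`, the two Lipschitz conjuncts of Σ-0bR₂ hold with NF-6's constant (`NetFlux.nearCentreFlux`, p668552).
[folklore] -/
theorem nearCentreLipschitz_of_eq_netFlux (v : ℝ → E3 → E3) (x₀ : E3) (T : ℝ → E3 → ℝ) (t₀ t₁ t₂ : ℝ)
    (h01 : t₀ < t₁) (h12 : t₁ ≤ t₂) (h20 : t₂ < 0)
    (hv : ContDiffOn ℝ (⊤ : ℕ∞) (uncurry v) (Ioo t₀ 0 ×ˢ (univ : Set E3)))
    (hT : ContDiffOn ℝ (⊤ : ℕ∞) (uncurry T) (Ioo t₀ 0 ×ˢ ({x₀}ᶜ : Set E3)))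
    (hlink : ∀ t ∈ Ioo t₀ 0, ∀ x, curl (v t) x = cross (gradient (T t) x) (x - x₀))
    (𝒞 : ℝ → ℝ → Set (Set E3))
    (heq : ∀ t ∈ Icc t₁ t₂, ∀ a ∈ Ioo (0 : ℝ) 1, clusterFlux (T t) a (𝒞 t a) = netFlux (T t) x₀ a) :
    ∃ κ : ℝ, 0 ≤ κ ∧ ∀ a₀ : ℝ, 0 < a₀ → a₀ ≤ 1 →
      (∀ t ∈ Icc t₁ t₂,
        LipschitzOnWith (Real.toNNReal (κ * a₀)) (fun r => clusterFlux (T t) r (𝒞 t r)) (Ioo 0 a₀)) ∧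
      (∀ t ∈ Icc t₁ t₂, ∀ t' ∈ Icc t₁ t₂, ∀ a ∈ Ioo 0 a₀,
        |clusterFlux (T t) a (𝒞 t a) - clusterFlux (T t') a (𝒞 t' a)| ≤ κ * a ^ 2 * |t - t'|) := by
  obtain ⟨κ, hκ, H⟩ := nearCentreFlux v x₀ T t₀ t₁ t₂ h01 h12 h20 hv hT hlink
  refine ⟨κ, hκ, fun a₀ ha₀ ha₁ => ?_⟩
  obtain ⟨H₁, H₂⟩ := H a₀ ha₀ ha₁
  have hsub : Ioo (0 : ℝ) a₀ ⊆ Ioo 0 1 := Ioo_subset_Ioo le_rfl ha₁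
  refine ⟨fun t ht => ?_, fun t ht t' ht' a ha => ?_⟩
  · intro x hx y hy
    have h := (H₁ t ht).2 hx hy
    simp only [heq t ht x (hsub hx), heq t ht y (hsub hy)]
    exact h
  · rw [heq t ht a (hsub ha), heq t' ht' a (hsub ha)]
    exact H₂ t ht t' ht' a ha

/-! ### Σ-0bR₂ in the sheet-free case -/

/-- **Σ-0bR₂ `ClusterFluxNearCentreLipschitz` in the SHEET-FREE case.**  Binders 1–14 and the conclusion are those of
`CellFlux.ClusterFluxNearCentreLipschitz` VERBATIM; the ONE extra hypothesis (inserted before `∀ 𝒞`) is that the window's spheres of radius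
`< 1` carry no sheet trace of `T t`, `t ∈ [t₁, t₂]`.  Then every admissible rule is `{S_a(x₀)}` there, its flux is the net flux, and NF-6
gives both conjuncts.  (The dense class-count hypothesis is idle in this case.) [folklore] -/
theorem clusterFluxNearCentreLipschitz_of_sheetFree :
    ∀ (v : ℝ → E3 → E3) (x₀ : E3) (T P : ℝ → E3 → ℝ) (V : ℝ → ℝ) (N₀ : ℕ) (t₀ t₁ t₂ : ℝ), t₀ < t₁ → t₁ ≤ t₂ → t₂ < 0 →
    ContDiffOn ℝ (⊤ : ℕ∞) (uncurry v) (Ioo t₀ 0 ×ˢ (univ : Set E3)) →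
    ContDiffOn ℝ (⊤ : ℕ∞) (uncurry T) (Ioo t₀ 0 ×ˢ ({x₀}ᶜ : Set E3)) →
    (∀ t ∈ Ioo t₀ 0, ∀ x, curl (v t) x = cross (gradient (T t) x) (x - x₀)) →
    Icc t₁ t₂ ×ˢ Ioo (0 : ℝ) 1 ⊆ closure {p : ℝ × ℝ | p.1 ∈ Ioo t₀ 0 ∧ 0 < p.2 ∧
        (cellSet (T p.1) x₀ p.2).Finite ∧ (cellSet (T p.1) x₀ p.2).ncard ≤ N₀} →
    (∀ t ∈ Icc t₁ t₂, ∀ a ∈ Ioo (0 : ℝ) 1, sheetTrace (T t) x₀ a = ∅) →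
    ∀ 𝒞 : ℝ → ℝ → Set (Set E3), AdmissibleRule x₀ T P V t₀ 𝒞 →
    ∃ κ : ℝ, 0 ≤ κ ∧ ∀ a₀ : ℝ, 0 < a₀ → a₀ ≤ 1 →
      (∀ t ∈ Icc t₁ t₂,
        LipschitzOnWith (Real.toNNReal (κ * a₀)) (fun r => clusterFlux (T t) r (𝒞 t r)) (Ioo 0 a₀)) ∧
      (∀ t ∈ Icc t₁ t₂, ∀ t' ∈ Icc t₁ t₂, ∀ a ∈ Ioo 0 a₀,
        |clusterFlux (T t) a (𝒞 t a) - clusterFlux (T t') a (𝒞 t' a)| ≤ κ * a ^ 2 * |t - t'|) := by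
  intro v x₀ T P V N₀ t₀ t₁ t₂ h01 h12 h20 hv hT hlink _ hsf 𝒞 h𝒞
  have hIcc : Icc t₁ t₂ ⊆ Ioo t₀ 0 := fun s hs => ⟨h01.trans_le hs.1, lt_of_le_of_lt hs.2 h20⟩
  refine nearCentreLipschitz_of_eq_netFlux v x₀ T t₀ t₁ t₂ h01 h12 h20 hv hT hlink 𝒞 fun t ht a ha => ?_
  exact clusterFlux_eq_netFlux_of_isClusterPartition ha.1 (hsf t ht a ha) (h𝒞.1 t (hIcc ht) a ha.1)

/-- **Σ-0bR₂ `ClusterFluxNearCentreLipschitz` on FINITE-CRITICAL small spheres** (the K3ᶠ regime): as `…_of_sheetFree`, with the extra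
hypothesis `(sphCrit (T t) x₀ a).Finite` for `t ∈ [t₁,t₂]`, `a ∈ (0,1)`. [folklore] -/
theorem clusterFluxNearCentreLipschitz_of_sphCritFinite :
    ∀ (v : ℝ → E3 → E3) (x₀ : E3) (T P : ℝ → E3 → ℝ) (V : ℝ → ℝ) (N₀ : ℕ) (t₀ t₁ t₂ : ℝ), t₀ < t₁ → t₁ ≤ t₂ → t₂ < 0 →
    ContDiffOn ℝ (⊤ : ℕ∞) (uncurry v) (Ioo t₀ 0 ×ˢ (univ : Set E3)) →
    ContDiffOn ℝ (⊤ : ℕ∞) (uncurry T) (Ioo t₀ 0 ×ˢ ({x₀}ᶜ : Set E3)) →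
    (∀ t ∈ Ioo t₀ 0, ∀ x, curl (v t) x = cross (gradient (T t) x) (x - x₀)) →
    Icc t₁ t₂ ×ˢ Ioo (0 : ℝ) 1 ⊆ closure {p : ℝ × ℝ | p.1 ∈ Ioo t₀ 0 ∧ 0 < p.2 ∧
        (cellSet (T p.1) x₀ p.2).Finite ∧ (cellSet (T p.1) x₀ p.2).ncard ≤ N₀} →
    (∀ t ∈ Icc t₁ t₂, ∀ a ∈ Ioo (0 : ℝ) 1, (sphCrit (T t) x₀ a).Finite) →
    ∀ 𝒞 : ℝ → ℝ → Set (Set E3), AdmissibleRule x₀ T P V t₀ 𝒞 →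
    ∃ κ : ℝ, 0 ≤ κ ∧ ∀ a₀ : ℝ, 0 < a₀ → a₀ ≤ 1 →
      (∀ t ∈ Icc t₁ t₂,
        LipschitzOnWith (Real.toNNReal (κ * a₀)) (fun r => clusterFlux (T t) r (𝒞 t r)) (Ioo 0 a₀)) ∧
      (∀ t ∈ Icc t₁ t₂, ∀ t' ∈ Icc t₁ t₂, ∀ a ∈ Ioo 0 a₀,
        |clusterFlux (T t) a (𝒞 t a) - clusterFlux (T t') a (𝒞 t' a)| ≤ κ * a ^ 2 * |t - t'|) := by
  intro v x₀ T P V N₀ t₀ t₁ t₂ h01 h12 h20 hv hT hlink hcount hfin 𝒞 h𝒞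
  exact clusterFluxNearCentreLipschitz_of_sheetFree v x₀ T P V N₀ t₀ t₁ t₂ h01 h12 h20 hv hT hlink hcount
    (fun t ht a ha => sheetTrace_eq_empty_of_finite (hfin t ht a ha)) 𝒞 h𝒞

end Summit.NavierStokesRegularity.NavierStokesRegularity.Theorems.PoloidalLiouville.CellFlux

end
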